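import Summits.QuantumFields.BalabanUV.T4Continuum.Support.ColourCovariantLaplacian

/-!
# T⁴ programme, spine node NE2 (U1a) — PLANTING THROUGH `t` FINE OWN-DIRECTION STEPS AND BLOCK AVERAGES OF SITE FAMILIES
# (tier B, row B3.a-vec of `t4/b2b-balaban-t4-ne2-p1/B-CLAIM-TABLE-NE2-P1.md`, file 1 of 3: the lattice combinatorics)

NE2 formalisation swarm, seat `b2b-balaban-t4-ne2-formalise-leaf-02`.  Row B3.a-vec models Bałaban's LINE-AVERAGED covariant vector
averaging ([Balaban1985Averaging] (124)/(125); the `Q` inside `Δ_a` of [Balaban1984PropagatorsI] (1.69) carries the line factor `v_μ` of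
(1.61), `BalabanLineAverage.QB = Qavg·Lavg`).  Its covariant version shifts planted (block-constant) fields by `t < R` fine steps along
their own direction before averaging; this file supplies the exact finite combinatorics of that, at two levels `(N, R)`:
 * §1 **`par_add_tstep`**: the block parent of `x + t·e_μ` (`t < R`) is `par x + e_μ` iff the own-direction offset `rem_μ(x) + t`
   reaches `R`, else `par x` (iterating `BlockPairingGeometry.par_add_unitVec`, torus wrap-around included);
 * §2 THE PLANTING IDENTITY FOR `t < R` FINE OWN-DIRECTION STEPS **`shiftT_mul_JK`**: `S′_t·J_R = J_R + F_t·J_R·(S_1 − 1)`, `F_t`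
   (`offInd t`) the diagonal indicator of the LAST `t` LAYERS `{rem_μ ≥ R − t}` of each block (`S_t` = `BalabanLineAverage.shiftT`,
   King's pairing `J_R = KingPairingPlantedLaw.JK`): a block-constant field shifted by `t` fine steps changes only there, where it sees
   the next block — the `t = 1` case is `BlockPairingGeometry.shift_sub_one_mul_JK`;
 * §3 block averages of scalar / colour-matrix site families `bavgS`, `bavg` and THE BLOCK-AVERAGE IDENTITY
   **`sqrt_smul_kronQavg_siteMul_kronJK`**: `√(R^d)•(Q_R ⊗ 1)·siteMul w·(J_R ⊗ 1) = siteMul (bavg w)` (via the matrix-unit decomposition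
   `KroneckerUnits.siteMul_eq_sum_kron_single` and the scalar identity `√(R^d)•Q_R·diag v·J_R = diag (bavgS v)`), with the pointwise bound
   `‖bavg w‖∞ ≤ ‖w‖∞`, `bavg 1 = 1`, linearity; the `R`-fold averaged families `Tgen v = R⁻¹Σ_t bavg (v t)`,
   `Wgen v = R⁻¹Σ_t bavg (𝟙_{F_t}·v t)` with `‖Tgen v − 1‖∞, ‖Wgen v − Wgen 1‖∞ ≤ ‖v − 1‖∞`, `‖Wgen v‖∞ ≤ ‖v‖∞`.
Files 2–3 (`Support/CovariantLineAveraging`, `Support/CovariantLineAveragingTower`) build the one-step covariant line-block average on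
these and derive `GramPerturbationLaw.AveragingLaws` for Bałaban's covariant averaging along the tower.

HONEST FRAMING (T4-DAG p. 1).  Exact `U = 1` lattice bookkeeping and elementary norm bounds; nothing printed is a hypothesis; no
transporter, contour or background object is constructed; NE2 NOT proved; NOT infinite volume / mass gap / Clay / summit progress;
spine 0/9 unchanged.  HONEST DEPENDENCY: continuum YM on T⁴ ⇐ BetaPertH ∧ nine spine estimates (0/9 proved); BetaPertH ⇐ (D1) ∧ (D4)
∧ CAP+tail; G-an2-4 gates asym, D1 and NE2/3/4.  ABSOLUTE RULE kept; no `sorry`.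
-/

noncomputable section

open scoped BigOperators ComplexConjugate Matrix Matrix.Norms.L2Operator Kronecker

namespace Summit.QuantumFields.BalabanUV.T4Continuum.CovariantLinePlanting

open Literature.MathematicalPhysics.QuantumFieldTheory.Balaban1983to89.B5Prop11Plancherel (fine Tor unitVec)
open Literature.MathematicalPhysics.QuantumFieldTheory.Balaban1983to89.B5Block118 (tstep tstep_zero tstep_succ)
open Literature.MathematicalPhysics.QuantumFieldTheory.Balaban1983to89.B5G183RateTorus (cpt)
open Literature.MathematicalPhysics.QuantumFieldTheory.Balaban1983to89.B5G183RateTorusW (off Qavg Qavg_mul_apply)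
open Summit.QuantumFields.BalabanUV.T4Continuum
open Summit.QuantumFields.BalabanUV.T4Continuum.BalabanAveragedTowerModes (par rem val_par par_cpt_add_off rem_cpt_add_off)
open Summit.QuantumFields.BalabanUV.T4Continuum.KingPairingPlantedLaw (JK sqrt_facts)
open Summit.QuantumFields.BalabanUV.T4Continuum.BlockPairingGeometry (parT JK_apply par_add_unitVec)
open Summit.QuantumFields.BalabanUV.T4Continuum.BlockMultiplication
open Summit.QuantumFields.BalabanUV.T4Continuum.KroneckerLift
open Summit.QuantumFields.BalabanUV.T4Continuum.KroneckerUnits (siteMul_eq_sum_kron_single siteMul_mul_kron_eq_sum sum_kronecker)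
open Summit.QuantumFields.BalabanUV.T4Continuum.BalabanLineAverage (shiftT shiftT_mul_apply shiftT_zero shiftT_eq_iff)

variable {d : ℕ}

/-! ## §1 The parent of a site shifted by `t < R` own-direction steps -/

section Parent

variable (N R : ℕ) [NeZero N] [NeZero R] (M : Fin d → ℕ) [hM : ∀ μ, NeZero (M μ)]

/-- the own-direction residue is additive along `t·e_μ`: `((x + t e_μ)_μ) mod R = (x_μ + t) mod R` (`R` divides the period). [folklore] -/
theorem val_add_tstep_mod (μ : Fin d) (x : Tor (fine (R * N) M)) (t : ℕ) :
    ((x + tstep (fine (R * N) M) μ t) μ).val % R = ((x μ).val + t) % R := by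
  have hdvd : R ∣ fine (R * N) M μ := ⟨N * M μ, by simp only [fine]; ring⟩
  have e : (x + tstep (fine (R * N) M) μ t) μ = x μ + (t : ZMod (fine (R * N) M μ)) := by
    simp [tstep]
  rw [e, ZMod.val_add, ZMod.val_natCast, Nat.mod_mod_of_dvd _ hdvd, Nat.add_mod, Nat.mod_mod_of_dvd _ hdvd, ← Nat.add_mod]

/-- **THE PARENT OF A SITE SHIFTED BY `t < R` OWN-DIRECTION STEPS**: `par(x + t e_μ) = par x + e_μ` if the offset `rem_μ(x) + t`
reaches the next block (`≥ R`), `= par x` otherwise. [cite: King1986, (2.10) p.653 («B^k(y)»)] [folklore] -/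
theorem par_add_tstep (μ : Fin d) (x : Tor (fine (R * N) M)) {t : ℕ} (ht : t < R) :
    par N R M (x + tstep (fine (R * N) M) μ t)
      = if R ≤ (x μ).val % R + t then par N R M x + unitVec (fine N M) μ else par N R M x := by
  have hR : 0 < R := Nat.pos_of_ne_zero (NeZero.ne R)
  have hr : (x μ).val % R < R := Nat.mod_lt _ hR
  induction t with
  | zero =>
    rw [tstep_zero, add_zero, if_neg]
    omega
  | succ t ih =>
    have ht' : t < R := by omega
    have ih' := ih ht'
    rw [tstep_succ, ← add_assoc, par_add_unitVec, ih']
    -- the divisibility test at this step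
    have hmod : ((x + tstep (fine (R * N) M) μ t) μ).val % R = ((x μ).val % R + t) % R := by
      rw [val_add_tstep_mod, Nat.add_mod]
      conv_rhs => rw [Nat.add_mod, Nat.mod_mod]
    have hdiv : (R ∣ ((x + tstep (fine (R * N) M) μ t) μ).val + 1) ↔ ((x μ).val % R + t + 1) % R = 0 := by
      rw [Nat.dvd_iff_mod_eq_zero, Nat.add_mod, hmod, ← Nat.add_mod]
    set r := (x μ).val % R with hr_def
    by_cases hjump : r + t + 1 = R
    · -- the step crosses the block boundary
      have h1 : (r + t + 1) % R = 0 := by rw [hjump, Nat.mod_self]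
      rw [if_pos (hdiv.mpr h1), if_neg (by omega), if_pos (by omega)]
    · have h1 : (r + t + 1) % R ≠ 0 := by
        intro h0
        by_cases hge : R ≤ r + t + 1
        · have h2 : (r + t + 1) % R = r + t + 1 - R := by
            rw [Nat.mod_eq_sub_mod hge, Nat.mod_eq_of_lt (by omega)]
          omega
        · rw [Nat.mod_eq_of_lt (by omega)] at h0
          omega
      rw [if_neg (fun h => h1 (hdiv.mp h))]
      by_cases hge : R ≤ r + t
      · rw [if_pos hge, if_pos (by omega)]
      · rw [if_neg hge, if_neg (by omega)]

end Parent

/-! ## §2 The planting identity for `t` fine own-direction steps -/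

section Planting

variable (N R : ℕ) [NeZero N] [NeZero R] (M : Fin d → ℕ) [hM : ∀ μ, NeZero (M μ)]

/-- the diagonal indicator `F_t` of the LAST `t` LAYERS of each block in the own direction: sites `(x, μ)` with `rem_μ(x) + t ≥ R`.
[folklore] -/
def offInd (t : ℕ) : Matrix (Tor (fine (R * N) M) × Fin d) (Tor (fine (R * N) M) × Fin d) ℂ :=
  Matrix.diagonal fun i => if R ≤ (i.1 i.2).val % R + t then 1 else 0

/-- the scalar indicator behind `offInd`. [folklore] -/
def ind (t : ℕ) (i : Tor (fine (R * N) M) × Fin d) : ℂ := if R ≤ (i.1 i.2).val % R + t then 1 else 0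

omit [NeZero N] [NeZero R] hM in
/-- `offInd t = diagonal (ind t)`. [folklore] -/
theorem offInd_eq (t : ℕ) : offInd N R M t = Matrix.diagonal (ind N R M t) := rfl

omit [NeZero N] [NeZero R] hM in
/-- `‖ind t i‖ ≤ 1`. [folklore] -/
theorem norm_ind_le (t : ℕ) (i : Tor (fine (R * N) M) × Fin d) : ‖ind N R M t i‖ ≤ 1 := by
  unfold ind; split_ifs <;> simp

/-- **THE PLANTING IDENTITY FOR `t < R` FINE OWN-DIRECTION STEPS**: `S′_t·J_R = J_R + F_t·J_R·(S_1 − 1)` — shifting a planted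
(block-constant) field by `t` fine steps along its own direction changes it only on the last `t` layers of each block, where it becomes
the planted field of the next block. [cite: King1986, (2.10) p.653] [folklore] -/
theorem shiftT_mul_JK {t : ℕ} (ht : t < R) :
    shiftT (fine (R * N) M) t * JK N R M
      = JK N R M + offInd N R M t * JK N R M * (shiftT (fine N M) 1 - 1) := by
  ext x y
  have eL : (shiftT (fine (R * N) M) t * JK N R M) x y = JK N R M (x.1 + tstep (fine (R * N) M) x.2 t, x.2) y :=
    shiftT_mul_apply _ t _ x y
  have hS : ((JK N R M * shiftT (fine N M) 1 : Matrix _ _ ℂ) x y) = JK N R M x (y.1 - tstep (fine N M) y.2 1, y.2) := by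
    rw [Matrix.mul_apply, Finset.sum_eq_single (y.1 - tstep (fine N M) y.2 1, y.2)]
    · simp only [shiftT]
      rw [if_pos ((shiftT_eq_iff (fine N M) 1 (y.1 - tstep (fine N M) y.2 1, y.2) y).mpr rfl), mul_one]
    · intro z _ hz
      simp only [shiftT]
      rw [if_neg (fun h => hz ((shiftT_eq_iff (fine N M) 1 z y).mp h)), mul_zero]
    · intro h; exact absurd (Finset.mem_univ _) h
  have eR : ((JK N R M + offInd N R M t * JK N R M * (shiftT (fine N M) 1 - 1) : Matrix _ _ ℂ) x y)
      = JK N R M x y + ind N R M t x * (JK N R M x (y.1 - tstep (fine N M) y.2 1, y.2) - JK N R M x y) := by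
    rw [Matrix.add_apply, Matrix.mul_assoc, offInd_eq, Matrix.diagonal_mul, Matrix.mul_sub, Matrix.mul_one, Matrix.sub_apply, hS]
  rw [eL, eR, JK_apply, JK_apply, JK_apply]
  simp only [parT]
  have c2 : ((par N R M x.1, x.2) = (y.1 - tstep (fine N M) y.2 1, y.2))
      ↔ ((par N R M x.1 + unitVec (fine N M) x.2, x.2) = y) := by
    constructor
    · intro h
      have h1 := (Prod.ext_iff.mp h).1
      have h2 := (Prod.ext_iff.mp h).2
      simp only at h1 h2
      refine Prod.ext ?_ h2
      simp only
      rw [h1, ← h2, BalabanLineAverage.tstep_one, sub_add_cancel]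
    · intro h
      rw [← h]
      simp [BalabanLineAverage.tstep_one]
  simp only [c2]
  have hp := par_add_tstep N R M x.2 x.1 ht
  unfold ind
  by_cases hf : R ≤ (x.1 x.2).val % R + t
  · rw [if_pos hf] at hp
    simp only [hp, if_pos hf, one_mul]
    ring
  · rw [if_neg hf] at hp
    simp only [hp, if_neg hf, zero_mul, add_zero]
    rfl

end Planting

/-! ## §3 Block averages of site families and the block-average identity -/

section BlockAverage

variable (N R : ℕ) [NeZero N] [NeZero R] (M : Fin d → ℕ) [hM : ∀ μ, NeZero (M μ)]

/-- the BLOCK AVERAGE of a scalar site family: `bavgS v (y, μ) = R^{−d} Σ_{j ∈ [0,R)^d} v (R·y + j, μ)`. [folklore] -/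
def bavgS (v : Tor (fine (R * N) M) × Fin d → ℂ) (i : Tor (fine N M) × Fin d) : ℂ :=
  ((R : ℂ) ^ d)⁻¹ * ∑ j : Fin d → Fin R, v (cpt N R M i.1 + off N R M j, i.2)

/-- **THE SCALAR BLOCK-AVERAGE IDENTITY**: `√(R^d)•(Q_R·diag v·J_R) = diag (bavgS v)` — multiplying a planted field by `v` and
averaging back is multiplying by the block average of `v`. [cite: King1986, (2.10) p.653] [folklore] -/
theorem sqrt_smul_Qavg_diagonal_JK (v : Tor (fine (R * N) M) × Fin d → ℂ) :
    ((((Real.sqrt ((R : ℝ) ^ d)) : ℝ) : ℂ)) • (Qavg N R M * Matrix.diagonal v * JK N R M)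
      = Matrix.diagonal (bavgS N R M v) := by
  obtain ⟨_, hss⟩ := sqrt_facts (d := d) R
  have hRc : ((R : ℂ) ^ d) ≠ 0 := pow_ne_zero _ (by exact_mod_cast NeZero.ne R)
  ext i y
  rw [Matrix.smul_apply, Matrix.mul_assoc, Qavg_mul_apply, Matrix.diagonal_apply, smul_eq_mul]
  have hj : ∀ j : Fin d → Fin R, (Matrix.diagonal v * JK N R M) (cpt N R M i.1 + off N R M j, i.2) y
      = v (cpt N R M i.1 + off N R M j, i.2)
        * ((((Real.sqrt ((R : ℝ) ^ d)) : ℝ) : ℂ) * (((R : ℂ) ^ d)⁻¹ * if i = y then 1 else 0)) := by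
    intro j
    rw [Matrix.diagonal_mul, JK_apply]
    simp only [parT, par_cpt_add_off]
  simp_rw [hj]
  rw [← Finset.sum_mul]
  by_cases h : i = y
  · rw [if_pos h, if_pos h, bavgS, mul_one]
    set S := ∑ j : Fin d → Fin R, v (cpt N R M i.1 + off N R M j, i.2)
    calc _ = ((((Real.sqrt ((R : ℝ) ^ d)) : ℝ) : ℂ) * (((Real.sqrt ((R : ℝ) ^ d)) : ℝ) : ℂ))
          * ((R : ℂ) ^ d)⁻¹ * (((R : ℂ) ^ d)⁻¹ * S) := by ring
      _ = ((R : ℂ) ^ d)⁻¹ * S := by rw [hss, mul_inv_cancel₀ hRc, one_mul]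
  · rw [if_neg h, if_neg h]
    simp

variable {o : Type*} [Fintype o] [DecidableEq o]

/-- the BLOCK AVERAGE of a site family of colour matrices: `bavg w (y, μ) = R^{−d} Σ_{x ∈ B(y)} w (x, μ)`. [folklore] -/
def bavg (w : Tor (fine (R * N) M) × Fin d → Matrix o o ℂ) (i : Tor (fine N M) × Fin d) : Matrix o o ℂ :=
  ((R : ℂ) ^ d)⁻¹ • ∑ j : Fin d → Fin R, w (cpt N R M i.1 + off N R M j, i.2)

omit [NeZero N] [NeZero R] hM [Fintype o] [DecidableEq o] in
/-- entries of `bavg` are the scalar block averages of the entries. [folklore] -/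
theorem bavg_apply (w : Tor (fine (R * N) M) × Fin d → Matrix o o ℂ) (i : Tor (fine N M) × Fin d) (a b : o) :
    bavg N R M w i a b = bavgS N R M (fun x => w x a b) i := by
  simp only [bavg, bavgS, Matrix.smul_apply, smul_eq_mul, Matrix.sum_apply]

/-- **THE BLOCK-AVERAGE IDENTITY**: `√(R^d)•(Q_R ⊗ 1)·siteMul w·(J_R ⊗ 1) = siteMul (bavg w)`. [cite: King1986, (2.10) p.653]
[folklore] -/
theorem sqrt_smul_kronQavg_siteMul_kronJK (w : Tor (fine (R * N) M) × Fin d → Matrix o o ℂ) :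
    ((((Real.sqrt ((R : ℝ) ^ d)) : ℝ) : ℂ))
        • ((Qavg N R M ⊗ₖ (1 : Matrix o o ℂ)) * siteMul w * (JK N R M ⊗ₖ (1 : Matrix o o ℂ)))
      = siteMul (bavg N R M w) := by
  rw [Matrix.mul_assoc, siteMul_mul_kron_eq_sum, Matrix.mul_sum, Finset.smul_sum,
    siteMul_eq_sum_kron_single (bavg N R M w)]
  refine Finset.sum_congr rfl fun a _ => ?_
  rw [Matrix.mul_sum, Finset.smul_sum]
  refine Finset.sum_congr rfl fun b _ => ?_
  rw [← Matrix.mul_kronecker_mul, Matrix.one_mul, ← Matrix.mul_assoc, ← Matrix.smul_kronecker,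
    sqrt_smul_Qavg_diagonal_JK]
  congr 1
  ext i j
  simp only [Matrix.diagonal_apply, bavg_apply]

omit [NeZero N] hM in
/-- pointwise bound of a block average: `‖bavg w i‖ ≤ c` if `‖w x‖ ≤ c` on the block. [folklore] -/
theorem norm_bavg_le {w : Tor (fine (R * N) M) × Fin d → Matrix o o ℂ} {c : ℝ} (hw : ∀ x, ‖w x‖ ≤ c)
    (i : Tor (fine N M) × Fin d) : ‖bavg N R M w i‖ ≤ c := by
  have hRd : (0 : ℝ) < (R : ℝ) ^ d := pow_pos (by exact_mod_cast Nat.pos_of_ne_zero (NeZero.ne R)) d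
  have hcard : (Finset.univ : Finset (Fin d → Fin R)).card = R ^ d := by
    rw [Finset.card_univ, Fintype.card_fun, Fintype.card_fin, Fintype.card_fin]
  rw [bavg, norm_smul, norm_inv, norm_pow, Complex.norm_natCast]
  calc ((R : ℝ) ^ d)⁻¹ * ‖∑ j : Fin d → Fin R, w (cpt N R M i.1 + off N R M j, i.2)‖
      ≤ ((R : ℝ) ^ d)⁻¹ * ∑ j : Fin d → Fin R, ‖w (cpt N R M i.1 + off N R M j, i.2)‖ :=
        mul_le_mul_of_nonneg_left (norm_sum_le _ _) (inv_nonneg.mpr hRd.le)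
    _ ≤ ((R : ℝ) ^ d)⁻¹ * ∑ _j : Fin d → Fin R, c :=
        mul_le_mul_of_nonneg_left (Finset.sum_le_sum fun j _ => hw _) (inv_nonneg.mpr hRd.le)
    _ = c := by rw [Finset.sum_const, hcard, nsmul_eq_mul]; push_cast; field_simp

omit [NeZero N] hM [Fintype o] in
/-- the block average of the constant family `1` is `1`. [folklore] -/
theorem bavg_one (i : Tor (fine N M) × Fin d) : bavg N R M (fun _ => (1 : Matrix o o ℂ)) i = 1 := by
  have hRc : ((R : ℂ) ^ d) ≠ 0 := pow_ne_zero _ (by exact_mod_cast NeZero.ne R)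
  have hcard : (Finset.univ : Finset (Fin d → Fin R)).card = R ^ d := by
    rw [Finset.card_univ, Fintype.card_fun, Fintype.card_fin, Fintype.card_fin]
  rw [bavg, Finset.sum_const, hcard, ← Nat.cast_smul_eq_nsmul ℂ, smul_smul]
  push_cast
  rw [inv_mul_cancel₀ hRc, one_smul]

omit [NeZero N] [NeZero R] hM [Fintype o] [DecidableEq o] in
/-- `bavg` is additive. [folklore] -/
theorem bavg_sub (w w' : Tor (fine (R * N) M) × Fin d → Matrix o o ℂ) (i : Tor (fine N M) × Fin d) :
    bavg N R M (fun x => w x - w' x) i = bavg N R M w i - bavg N R M w' i := by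
  simp only [bavg, Finset.sum_sub_distrib, smul_sub]

omit [NeZero N] [NeZero R] hM [Fintype o] [DecidableEq o] in
/-- `bavg` commutes with finite sums. [folklore] -/
theorem bavg_finset_sum {σ : Type*} (s : Finset σ) (w : σ → Tor (fine (R * N) M) × Fin d → Matrix o o ℂ)
    (i : Tor (fine N M) × Fin d) : bavg N R M (fun x => ∑ t ∈ s, w t x) i = ∑ t ∈ s, bavg N R M (w t) i := by
  simp only [bavg, Finset.smul_sum]
  rw [Finset.sum_comm]

omit [NeZero N] [NeZero R] hM [Fintype o] [DecidableEq o] in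
/-- `bavg` is homogeneous. [folklore] -/
theorem bavg_smul (c : ℂ) (w : Tor (fine (R * N) M) × Fin d → Matrix o o ℂ) (i : Tor (fine N M) × Fin d) :
    bavg N R M (fun x => c • w x) i = c • bavg N R M w i := by
  simp only [bavg, ← Finset.smul_sum, smul_comm c]

/-! ### The `R`-fold averaged families `Tgen`, `Wgen` (used by the one-step planting identity of file 2) -/

/-- the `R`-fold average of the block averages of a `t`-indexed family: `Tgen v = R⁻¹ Σ_t bavg (v t)`. [folklore] -/
def Tgen (v : Fin R → Tor (fine (R * N) M) × Fin d → Matrix o o ℂ) (i : Tor (fine N M) × Fin d) : Matrix o o ℂ :=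
  ((R : ℂ))⁻¹ • ∑ t : Fin R, bavg N R M (v t) i

/-- the same with the last-`t`-layers indicator inserted: `Wgen v = R⁻¹ Σ_t bavg (𝟙_{F_t}·v t)`. [folklore] -/
def Wgen (v : Fin R → Tor (fine (R * N) M) × Fin d → Matrix o o ℂ) (i : Tor (fine N M) × Fin d) : Matrix o o ℂ :=
  ((R : ℂ))⁻¹ • ∑ t : Fin R, bavg N R M (fun x => ind N R M (t : ℕ) x • v t x) i

omit [NeZero N] hM in
/-- pointwise size of `Tgen`. [folklore] -/
theorem norm_Tgen_le {v : Fin R → Tor (fine (R * N) M) × Fin d → Matrix o o ℂ} {c : ℝ} (hv : ∀ t x, ‖v t x‖ ≤ c)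
    (i : Tor (fine N M) × Fin d) : ‖Tgen N R M v i‖ ≤ c := by
  have hR : (0 : ℝ) < R := by exact_mod_cast Nat.pos_of_ne_zero (NeZero.ne R)
  rw [Tgen, norm_smul, norm_inv, Complex.norm_natCast]
  calc (R : ℝ)⁻¹ * ‖∑ t : Fin R, bavg N R M (v t) i‖ ≤ (R : ℝ)⁻¹ * ∑ t : Fin R, ‖bavg N R M (v t) i‖ :=
        mul_le_mul_of_nonneg_left (norm_sum_le _ _) (inv_nonneg.mpr hR.le)
    _ ≤ (R : ℝ)⁻¹ * ∑ _t : Fin R, c :=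
        mul_le_mul_of_nonneg_left (Finset.sum_le_sum fun t _ => norm_bavg_le N R M (hv t) i) (inv_nonneg.mpr hR.le)
    _ = c := by rw [Finset.sum_const, Finset.card_univ, Fintype.card_fin, nsmul_eq_mul]; field_simp

omit [NeZero N] hM in
/-- pointwise size of `Wgen` (the indicator only removes terms). [folklore] -/
theorem norm_Wgen_le {v : Fin R → Tor (fine (R * N) M) × Fin d → Matrix o o ℂ} {c : ℝ} (hv : ∀ t x, ‖v t x‖ ≤ c)
    (i : Tor (fine N M) × Fin d) : ‖Wgen N R M v i‖ ≤ c := by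
  have hv' : ∀ (t : Fin R) x, ‖ind N R M (t : ℕ) x • v t x‖ ≤ c := fun t x => by
    rw [norm_smul]
    calc ‖ind N R M (t : ℕ) x‖ * ‖v t x‖ ≤ 1 * c := mul_le_mul (norm_ind_le N R M _ x) (hv t x) (norm_nonneg _) zero_le_one
      _ = c := one_mul c
  exact norm_Tgen_le N R M (v := fun t x => ind N R M (t : ℕ) x • v t x) hv' i

omit [NeZero N] hM [Fintype o] in
/-- `Tgen` of the constant family `1` is `1`. [folklore] -/
theorem Tgen_one (i : Tor (fine N M) × Fin d) : Tgen N R M (fun (_ : Fin R) (_ : Tor (fine (R * N) M) × Fin d) => (1 : Matrix o o ℂ)) i = 1 := by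
  have hRc : ((R : ℂ)) ≠ 0 := by exact_mod_cast NeZero.ne R
  rw [Tgen]
  simp_rw [bavg_one]
  rw [Finset.sum_const, Finset.card_univ, Fintype.card_fin, ← Nat.cast_smul_eq_nsmul ℂ, smul_smul, inv_mul_cancel₀ hRc, one_smul]

omit [NeZero N] [NeZero R] hM [Fintype o] [DecidableEq o] in
/-- `Tgen` is additive. [folklore] -/
theorem Tgen_sub (v v' : Fin R → Tor (fine (R * N) M) × Fin d → Matrix o o ℂ) (i : Tor (fine N M) × Fin d) :
    Tgen N R M (fun t x => v t x - v' t x) i = Tgen N R M v i - Tgen N R M v' i := by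
  simp only [Tgen, bavg_sub, Finset.sum_sub_distrib, smul_sub]

omit [NeZero N] [NeZero R] hM [Fintype o] [DecidableEq o] in
/-- `Wgen` is additive. [folklore] -/
theorem Wgen_sub (v v' : Fin R → Tor (fine (R * N) M) × Fin d → Matrix o o ℂ) (i : Tor (fine N M) × Fin d) :
    Wgen N R M (fun t x => v t x - v' t x) i = Wgen N R M v i - Wgen N R M v' i := by
  simp only [Wgen, smul_sub, bavg_sub, Finset.sum_sub_distrib]

omit [NeZero N] hM in
/-- **`‖Tgen v − 1‖∞ ≤ sup ‖v − 1‖`**. [folklore] -/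
theorem norm_Tgen_sub_one_le {v : Fin R → Tor (fine (R * N) M) × Fin d → Matrix o o ℂ} {c : ℝ} (hv : ∀ t x, ‖v t x - 1‖ ≤ c)
    (i : Tor (fine N M) × Fin d) : ‖Tgen N R M v i - 1‖ ≤ c := by
  rw [← Tgen_one N R M i, ← Tgen_sub]
  exact norm_Tgen_le N R M hv i

omit [NeZero N] hM in
/-- **`‖Wgen v − Wgen 1‖∞ ≤ sup ‖v − 1‖`**. [folklore] -/
theorem norm_Wgen_sub_Wgen_one_le {v : Fin R → Tor (fine (R * N) M) × Fin d → Matrix o o ℂ} {c : ℝ}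
    (hv : ∀ t x, ‖v t x - 1‖ ≤ c) (i : Tor (fine N M) × Fin d) :
    ‖Wgen N R M v i - Wgen N R M (fun (_ : Fin R) (_ : Tor (fine (R * N) M) × Fin d) => (1 : Matrix o o ℂ)) i‖ ≤ c := by
  rw [← Wgen_sub]
  exact norm_Wgen_le N R M hv i

end BlockAverage

end Summit.QuantumFields.BalabanUV.T4Continuum.CovariantLinePlanting

end
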